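import Summits.CriticalPhenomena.PercolationContinuityZ3.Theorems.PercNearOneGluingNoHeavyLowerTailKNGoodPocketBHKTwoSets
import Literature.Probability.Percolation.KozmaNitzanSeparatingTriple
import HarnessLib

/-!
# `NoHeavyLowerTail` (stmt-CriticalPhenomena-4575) — universal goodness at `|A| = 3`, B-side: THE TWO-WORLD INEQUALITY
# of a separated quadruple (Conjecture B3's kernel)

Support file (`--supports stmt-CriticalPhenomena-4575`, hull-port prover `prim-hp-2`, gen 21).  No named facts, no sorries;
standard axioms.

For a separated Kozma–Nitzan quadruple `S : KNSep.SepData` (Literature `KozmaNitzanSeparatingTriple.lean`: interior `VB ∋ o`,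
relays `a₁ a₂ a₃`, target `b`, `B`-connectivity `S.rb`, `B`-events `S.ev Φ`), vertices `x, y, z` and ANY family `𝒬` of
vertex sets not containing `z`:
* `KNGoodB3.two_world` — **`μ([xy]) · μ(sep ∩ F) ≤ μ(sep) · μ([xy] ∩ F)`**, where `[xy] = {x ↔_B y, z ↮_B x,y}`,
  `sep = {x,y,z pairwise B-separated}`, `F = {o ↔_B x ∨ o ↔_B y} ∪ {C_B(o) ∈ 𝒬}` (`KNGoodB3.Dp`, `KNGoodB3.Fp`);
  i.e. `P(F | [xy]) ≥ P(F | sep)` — the pocket-augmented BHK inequality (`KNGoodPocketBHK.real_pocketAugSet_openConn_ge`)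
  on the `B`-side model `S.wB`, read back on `μ` by `SepData.real_ev_eq`.
With `{x,y,z} = {a₁,a₂,a₃}` these are the inequalities (I) of the `|A| = 3` goodness reduction R3 (prim-hp-2 MEMO-gen12 §6,
MEMO-gen21 §3); the cell forms and the assembly follow in `…KNGoodB3Cells.lean` / `…KNGoodB3Worlds.lean`.
[cite: KozmaNitzan2024, §3.2 (p. 12), proof of Thm. 3 (pp. 10–11)] [cite: VandenbergHaggstromKahn2005, Thm. 1.1 (pp. 3–5)]
-/

noncomputable section

namespace Summit.CriticalPhenomena.PercolationContinuityZ3.Theorems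

open MeasureTheory Set Literature.Probability.LatticeModels Literature.Probability.Percolation
open scoped Classical

namespace KNGoodB3

open KNSep KNGoodPocketBHK

variable {V : Type*} [Fintype V] (S : SepData V)

/-- `B`-predicate: the relay `z` is `B`-joined to neither `x` nor `y`. [cite: KozmaNitzan2024, proof of Thm. 3 (p. 10)] -/
def Dp (x y z : V) (r : V → V → Prop) : Prop := ¬ r x z ∧ ¬ r y z

/-- `B`-predicate of the pocket-augmented event for the pair `{x, y}`:
`F = {o ↔_B x ∨ o ↔_B y} ∪ {C_B(o) ∈ 𝒬}`. [cite: KozmaNitzan2024, §3.2 (p. 12)] -/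
def Fp (x y : V) (Q : Set (Set V)) (r : V → V → Prop) : Prop := (r S.o x ∨ r S.o y) ∨ {v | r S.o v} ∈ Q

/-- **THE TWO-WORLD INEQUALITY.**  For a separated quadruple `S`, vertices `x, y, z` and ANY family `𝒬` of vertex sets
not containing `z`: with the `B`-worlds `[xy] = {x ↔_B y, z ↮_B x, y}` and `sep = {x, y, z pairwise B-separated}` and
`F = {o ↔_B {x,y}} ∪ {C_B(o) ∈ 𝒬}`,
`μ([xy]) · μ(sep ∩ F) ≤ μ(sep) · μ([xy] ∩ F)`,  i.e. `P(F | [xy]) ≥ P(F | sep)`.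
(The pocket-augmented BHK inequality for the sets `{x,y}`, `{z}` on the `B`-side model `S.wB`, read back on `μ` by
`SepData.real_ev_eq`.)  With `{x,y,z} = A` these are the inequalities (I)_z of the `|A| = 3` goodness reduction
(prim-hp-2 MEMO-gen12 §6, MEMO-gen21 §3). [cite: KozmaNitzan2024, §3.2 (p. 12), proof of Thm. 3 (pp. 10–11)]
[cite: VandenbergHaggstromKahn2005, Thm. 1.1 (pp. 3–5)] -/
theorem two_world (x y z : V) (Q : Set (Set V)) (hQ : ∀ W ∈ Q, z ∉ W) :
    (prodBernoulli S.w).real (S.ev fun r => r x y ∧ Dp x y z r) *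
        (prodBernoulli S.w).real (S.ev fun r => (¬ r x y ∧ Dp x y z r) ∧ Fp S x y Q r) ≤
      (prodBernoulli S.w).real (S.ev fun r => ¬ r x y ∧ Dp x y z r) *
        (prodBernoulli S.w).real (S.ev fun r => (r x y ∧ Dp x y z r) ∧ Fp S x y Q r) := by
  classical
  have hQ' : ∀ W ∈ Q, Disjoint W ({z} : Set V) := fun W hW => Set.disjoint_singleton_right.2 (hQ W hW)
  have key := real_pocketAugSet_openConn_ge S.wB ({x, y} : Set V) {z} x y S.o (by simp) Q hQ'
  -- the four events of the `B`-model as `B`-predicates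
  set ΦD : (V → V → Prop) → Prop := fun r => Dp x y z r with hΦD
  set ΦC : (V → V → Prop) → Prop := fun r => r x y ∧ Dp x y z r with hΦC
  set ΦF : (V → V → Prop) → Prop := fun r => Dp x y z r ∧ Fp S x y Q r with hΦF
  set ΦCF : (V → V → Prop) → Prop := fun r => (r x y ∧ Dp x y z r) ∧ Fp S x y Q r with hΦCF
  have hD : avoidSet ({x, y} : Set V) {z} = {ω | ΦD fun u v => (openGraph ω).Reachable u v} := by
    ext ω; simp [avoidSet, Dp, hΦD]
  have hC : openConn x y ∩ avoidSet ({x, y} : Set V) {z} = {ω | ΦC fun u v => (openGraph ω).Reachable u v} := by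
    rw [hD]; ext ω; simp [openConn, hΦC, hΦD]
  have hF : pocketAugSet ({x, y} : Set V) S.o Q ∩ avoidSet ({x, y} : Set V) {z} =
      {ω | ΦF fun u v => (openGraph ω).Reachable u v} := by
    rw [hD]; ext ω
    simp only [pocketAugSet, Fp, openCluster, Set.mem_inter_iff, Set.mem_setOf_eq, Set.mem_insert_iff,
      Set.mem_singleton_iff, exists_eq_or_imp, exists_eq_left, hΦF, hΦD]
    tauto
  have hCF : openConn x y ∩ (pocketAugSet ({x, y} : Set V) S.o Q ∩ avoidSet ({x, y} : Set V) {z}) =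
      {ω | ΦCF fun u v => (openGraph ω).Reachable u v} := by
    rw [hF]; ext ω; simp only [openConn, Set.mem_inter_iff, Set.mem_setOf_eq, hΦCF, hΦF]; tauto
  rw [hCF, hC, hF, hD, ← S.real_ev_eq ΦC, ← S.real_ev_eq ΦF, ← S.real_ev_eq ΦD, ← S.real_ev_eq ΦCF] at key
  -- split `D = [xy] ⊔ sep`
  have s1 := S.real_split_ev Set.univ ΦD (fun r => r x y)
  have s2 := S.real_split_ev Set.univ ΦF (fun r => r x y)
  simp only [Set.univ_inter] at s1 s2
  have e1 : S.ev (fun r => ΦD r ∧ r x y) = S.ev ΦC := by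
    ext ω; simp only [SepData.mem_ev, hΦD, hΦC]; tauto
  have e2 : S.ev (fun r => ΦD r ∧ ¬ r x y) = S.ev (fun r => ¬ r x y ∧ Dp x y z r) := by
    ext ω; simp only [SepData.mem_ev, hΦD]; tauto
  have e3 : S.ev (fun r => ΦF r ∧ r x y) = S.ev ΦCF := by
    ext ω; simp only [SepData.mem_ev, hΦF, hΦCF]; tauto
  have e4 : S.ev (fun r => ΦF r ∧ ¬ r x y) = S.ev (fun r => (¬ r x y ∧ Dp x y z r) ∧ Fp S x y Q r) := by
    ext ω; simp only [SepData.mem_ev, hΦF]; tauto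
  rw [e1, e2] at s1
  rw [e3, e4] at s2
  rw [s1, s2] at key
  have h0 : 0 ≤ (prodBernoulli S.w).real (S.ev ΦCF) := measureReal_nonneg
  show (prodBernoulli S.w).real (S.ev ΦC) *
      (prodBernoulli S.w).real (S.ev fun r => (¬ r x y ∧ Dp x y z r) ∧ Fp S x y Q r) ≤
    (prodBernoulli S.w).real (S.ev fun r => ¬ r x y ∧ Dp x y z r) * (prodBernoulli S.w).real (S.ev ΦCF)
  nlinarith [key, h0]

end KNGoodB3

end Summit.CriticalPhenomena.PercolationContinuityZ3.Theorems
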